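import Summits.BirchSwinnertonDyer.Rank1Residual.X11b.KolyvaginReciprocityFinsetOfPoitouTate
import Literature.NumberTheory.EllipticCurves.HeegnerPointsKolyvaginProp82Proofs
import Literature.NumberTheory.EllipticCurves.HeegnerPointsKolyvaginReducedTrustBaseProofs
import Literature.NumberTheory.GaloisCohomology.PoitouTateNumberField
import Summits.BirchSwinnertonDyer.BirchSwinnertonDyer.Theorems.SemiOrdinaryEisensteinDescentWildKolyvaginUpperAtThreeOfPrimitives
import HarnessLib

/-!
# Gross 1991, Prop. 8.2 DISCHARGED: the leaf `Gross1991_prop_8_2` of Kolyvagin's theorem from the tree's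
# Poitou–Tate reciprocity (now a kernel theorem) — `kolyvagin N W K` rests on THREE leaves

Seat `bsd-wall-soed-p2-w2` g2 (route `SemiOrdinaryEisensteinDescent`, crux Ko stmt-BirchSwinnertonDyer-20480, whose
line `birth` v3 carries `∀ N W K, kolyvagin N W K` as conjunct (i) of its print stub `stub_inputsPrim`;
`--supports stmt-BirchSwinnertonDyer-20480`). THEOREMS ONLY (no definition, no named fact, no `sorry`). BSD is not
proved by any of this; what moves is the TRUST BASE of the named fact `kolyvagin` (Kolyvagin 1990 Thm. A /
Gross 1991 Thm. 1.3), used by name in the published-inputs package of every rank-one BSD route of the tree.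

STATE BEFORE THIS FILE. `Literature/…/HeegnerPointsKolyvaginReducedTrustBaseProofs.lean` records
`kolyvagin_of_fourLeaves : Gross1991_kolyvaginClasses → Gross1991_prop_8_2 → Kolyvagin1990_sha_primary_finite →
Kolyvagin1990_thmA_of_hasCM_or_discr → kolyvagin N W K`, with the remark (2026-08-15) «neither local Tate duality,
nor the reciprocity law for the Brauer group of a number field … is available, so none of the four leaves is
dischargeable at present», and `Gross1991_prop_8_2_of_kolyvaginReciprocity` reducing the second leaf to
Kolyvagin's reciprocity law (R) at the Kolyvagin primes. Since then: (a) cell `bsd-cn100` PROVED the Poitou–Tate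
reciprocity `poitouTate_sum_localTatePairing_eq_zero_holds` (every number field `K : Type`; Tate, C–F VII §11;
`GaloisCohomology/PoitouTateNumberField.lean`), and (b) cell `b2b-bsdres` (x11b3) derived (R)_M at a Kolyvagin
place from that fact (`X11b.KolyvaginReciprocity.kolyvaginReciprocityFinset_of_poitouTate`, level `p^M`, whose
statement however carries the binder `¬ IsOfFinAddOrder P` — idle in its proof — which the leaf
`Gross1991_prop_8_2` does not supply: the obstruction noted by width seat w2 g0, 2026-08-27).

THIS FILE. §1 re-runs the x11b3 derivation AT LEVEL `p` with exactly the binders its proof uses (the Heegner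
point `P` enters only through `IsHeegnerPoint`, for good reduction at `λ`; no non-torsion, no image, no CM, no
discriminant hypothesis): `kolyvaginReciprocity_of_poitouTate`. §2 feeds it to the tree's per-instance
Prop. 8.2 (`Gross1991_prop_8_2_at_of_reciprocity`, McCallum's eigen-argument PROVED there):
`gross1991_prop_8_2_of_poitouTate` (CONDITIONAL on the PT fact at `K : Type u`) and
**`gross1991_prop_8_2_holds : Gross1991_prop_8_2 N W K` for every `K : Type`** (the fact's `_holds` lives in
universe `0`, where the PT discharge lives). §3: **`kolyvagin_of_threeLeaves`** — Kolyvagin's theorem from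
{`Gross1991_kolyvaginClasses` (CM theory on `X_0(N)` + the Euler-system relations, Gross §§3–6),
`Kolyvagin1990_sha_primary_finite` (Thm. 1.3 (2) beyond Gross's sketch), `Kolyvagin1990_thmA_of_hasCM_or_discr`
(the CM / `d_K ∈ {−3,−4}` cases)} — the reciprocity/duality leaf is GONE.

Proof of §1 = the x11b3 proof verbatim at level `p` (credit: cell `b2b-bsdres`, files
`KolyvaginReciprocityOfPoitouTate` / `…FinsetOfPoitouTate`): Weil pairing on `E[p]` (`exists_weilPairing_holds`);
global half — the Kummer images are isotropic off `λ` (`kummerClass_cupProduct_kummerClass_eq_zero_holds`), the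
Poitou–Tate sum over `S = {λ}` (`sum_inv_weilCupProduct_localization_eq_zero`) kills the term at `λ`, `inv_λ` is
injective; local half at `K_λ` — `TameCup.weilPairing_apply_eq_one_of_cupProduct_eq_zero` (Gross (7.6),
qualitative), transported along `g • 𝔔 = 𝔓₀`.

References: [GrossLMS1991] §7 (7.1), (7.6), §8 Props. 8.1–8.2, §9; [McCallumLMS1991] §2 Prop. 2.2, §3;
[MilneADT2006] I Thm. 4.10 (b), Cor. 2.3; [CasselsFrohlichANT1967] VII §11; [KolyvaginEulerSystems1990] Thm. A.
-/

set_option autoImplicit false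
set_option linter.dupNamespace false -- `Summit.BirchSwinnertonDyer.BirchSwinnertonDyer.…` is the tree's layout (D-0017)

noncomputable section

open scoped Classical Pointwise

universe u

namespace Summit.BirchSwinnertonDyer.BirchSwinnertonDyer.Theorems.GrossProp82OfPoitouTate

open WeierstrassCurve NumberField IsDedekindDomain Field Function ValuativeRel
open Literature.NumberTheory.EllipticCurves
open Literature.NumberTheory.GaloisRepresentations
open Literature.NumberTheory.GaloisRepresentations.IsNonarchimedeanLocalField
open Literature.NumberTheory.GaloisCohomology
open Literature.NumberTheory.GaloisRepresentations.DiscreteGaloisModule (mu MuCarrier)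
open Summit.BirchSwinnertonDyer.Rank1Residual
open Summit.BirchSwinnertonDyer.Rank1Residual.X11b
open Summit.BirchSwinnertonDyer.Rank1Residual.X11b.KolyvaginReciprocity

variable (N : ℕ) [NeZero N] (W : WeierstrassCurve ℚ) (K : Type u) [Field K] [NumberField K]

/-! ## §1 Kolyvagin's reciprocity (R) at level `p`, from Poitou–Tate, with the leaf's binders only -/

/-- **Kolyvagin reciprocity (R) at a Kolyvagin prime, level `p`, from Poitou–Tate** — the hypothesis `hR` of
`Gross1991_prop_8_2_of_kolyvaginReciprocity` / `kolyvagin_of_kolyvaginClasses_of_reciprocity`, under the binders the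
proof actually uses: `E = W/ℚ` elliptic, a Heegner point `P` over `K` (only to place the bad primes off `λ`), `p`
prime, `ℓ` a Kolyvagin prime. For the Weil pairing `e` on `E[p]` (bi-additive, alternating, left-non-degenerate):
`e([s, F], [c', σ]) = 0` for every `s ∈ Sel_p(E/K)`, every `c' ∈ H¹(K, E[p])` Selmer at the finite places `v ∤ ℓ`
and at infinity, every prime `𝔔 ∣ λ`, arithmetic Frobenius `F` at `𝔔` fixing `E[p]` and `σ ∈ I_𝔔`. Gross 1991,
proof of Prop. 8.2 («the sum of local invariants is zero, by the reciprocity law of global class field theory»)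
with (7.6); = x11b3's `kolyvaginReciprocityFinset_of_poitouTate` at `M = 1`, `T = ∅`, idle binders removed.
CONDITIONAL on `hPT` (PROVED for `K : Type`: `poitouTate_sum_localTatePairing_eq_zero_holds`).
[cite: GrossLMS1991, §7 (7.1), (7.6), Prop. 8.2 (proof), §9] [cite: McCallumLMS1991, §2 Prop. 2.2]
[cite: MilneADT2006, Ch. I Thm. 4.10(b), Cor. 2.3] -/
theorem kolyvaginReciprocity_of_poitouTate (hPT : poitouTate_sum_localTatePairing_eq_zero K)
    [W.IsElliptic] {P : (W.baseChange K).toAffine.Point} (hP : IsHeegnerPoint N W K P)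
    {p : ℕ} (hp : p.Prime) {ℓ : ℕ} (hℓ : IsKolyvaginPrime N W K p ℓ) :
    ∃ (A : Type u) (_ : AddCommGroup A)
      (e : geomTorsion (W.baseChange K) p →+ geomTorsion (W.baseChange K) p →+ A),
      (∀ x, e x x = 0) ∧ (∀ x, (∀ y, e x y = 0) → x = 0) ∧
      ∀ s ∈ selmerGroup (W.baseChange K) p, ∀ c' : galH1Torsion (W.baseChange K) p,
        (∀ v : HeightOneSpectrum (𝓞 K), (ℓ : 𝓞 K) ∉ v.asIdeal →
          c' ∈ selmerLocalKer (W.baseChange K) (v.adicCompletion K) p) →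
        (∀ w : InfinitePlace K, c' ∈ selmerLocalKer (W.baseChange K) w.Completion p) →
        ∀ 𝔔 ∈ hℓ.place.primesAbove, ∀ F : absoluteGaloisGroup K, IsArithFrobAt (𝓞 K) F 𝔔 →
          F ∈ torsionFixing (W.baseChange K) p → ∀ σ ∈ 𝔔.inertia (absoluteGaloisGroup K),
          e (h1Eval (W.baseChange K) p s F) (h1Eval (W.baseChange K) p c' σ) = 0 := by
  -- compactness of absolute Galois groups (cup products), as a local hypothesis
  have _hΓc : ∀ (L : Type u) [Field L], CompactSpace (absoluteGaloisGroup L) :=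
    fun L _ => absoluteGaloisGroup_compactSpace L
  haveI : NeZero p := ⟨hp.ne_zero⟩
  haveI : (W.baseChange K).IsElliptic := inferInstanceAs (W.map (algebraMap ℚ K)).IsElliptic
  have hq2 : 2 ≤ p := hp.two_le
  have hqK : ((p : ℕ) : K) ≠ 0 := Nat.cast_ne_zero.mpr (NeZero.ne p)
  have hp0 : ((p : ℕ) : ℤ) ≠ 0 := by exact_mod_cast NeZero.ne p
  -- the Weil pairing on `E[p]` over `K`
  obtain ⟨e, hμ, hadd₁, hadd₂, halt, hnondeg, hgal⟩ :=
    (W.baseChange K).exists_weilPairing_holds p hq2 hqK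
  refine ⟨MuCarrier K p, inferInstance,
    weilPairingHom (W.baseChange K) p e hμ hadd₁ hadd₂,
    weilPairingHom_self (W.baseChange K) p e hμ hadd₁ hadd₂ halt,
    TameCup.weilPairingHom_left_nondeg (W.baseChange K) p e hμ hadd₁ hadd₂ halt hnondeg, ?_⟩
  intro s hs c' hc'fin hc'inf 𝔔 h𝔔 F hF hFfix σ hσ
  -- ### the family of local invariant maps of the Poitou–Tate fact at level `p`
  obtain ⟨inv, hperf, hsum⟩ := hPT p
  set lam := hℓ.place
  -- ### the finite set of places `S = {λ}`
  set S : Finset (Place K) := {Sum.inr lam} with hSdef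
  have hmemS : Sum.inr lam ∈ S := Finset.mem_singleton_self _
  -- ### local terms vanish off `S`: both classes satisfy the Kummer condition there (isotropy)
  have hsS : s ∈ ((W.baseChange K).kummerSelmerStructure ((p : ℕ) : ℤ)).selmerGroup := by
    rw [← selmerGroup_eq_selmerGroup_kummerSelmerStructure]; exact hs
  have hloc_s : ∀ v : Place K, galoisCohomology.localization ((W.baseChange K).torsionGaloisModule ((p : ℕ) : ℤ)) v 1 s ∈
      (W.baseChange K).kummerSelmerStructure ((p : ℕ) : ℤ) v :=
    ((((W.baseChange K).kummerSelmerStructure ((p : ℕ) : ℤ)).mem_selmerGroup_iff s).mp hsS)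
  have hloc_c' : ∀ v : Place K, v ∉ S →
      galoisCohomology.localization ((W.baseChange K).torsionGaloisModule ((p : ℕ) : ℤ)) v 1 c' ∈
        (W.baseChange K).kummerSelmerStructure ((p : ℕ) : ℤ) v := by
    intro v hv
    have hmem : c' ∈ selmerLocalKer (W.baseChange K) (Place.Completion v) ((p : ℕ) : ℤ) := by
      rcases v with w | v
      · exact hc'inf w
      · refine hc'fin v (fun h => hv ?_)
        rw [hℓ.mem_iff.mp h]
        exact hmemS
    rw [← (W.baseChange K).comap_localization_kummerSelmerStructure ((p : ℕ) : ℤ) v] at hmem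
    exact hmem
  have hS : ∀ v ∉ S,
      inv v ((weilContPairingLocal (W.baseChange K) p e hμ hadd₁ hadd₂ hgal v).cupProduct
        (galoisCohomology.localization ((W.baseChange K).torsionGaloisModule ((p : ℕ) : ℤ)) v 1 s)
        (galoisCohomology.localization ((W.baseChange K).torsionGaloisModule ((p : ℕ) : ℤ)) v 1 c')) = 0 := by
    intro v hv
    have h0 := (W.baseChange K).cupProduct_eq_zero_of_mem_kummerSelmerStructure_of_fact p e
      (by exact_mod_cast NeZero.ne p) v (kummerClass_cupProduct_kummerClass_eq_zero_holds (Place.Completion v))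
      hμ hadd₁ hadd₂ halt hgal (hloc_s v) (hloc_c' v hv)
    exact (congrArg (inv v) h0).trans (map_zero _)
  -- ### Poitou–Tate: the local term at `λ` vanishes too, hence the local cup product is zero
  have hPTsum := sum_inv_weilCupProduct_localization_eq_zero (W.baseChange K) p e hμ hadd₁ hadd₂ hgal
    inv hsum s c' S hS
  rw [Finset.sum_singleton] at hPTsum
  have hcup : ((weilContPairing (W.baseChange K) p e hμ hadd₁ hadd₂ hgal).restrict
      (absGaloisRestrict K (lam.adicCompletion K))).cupProduct
        (galoisCohomology.localization ((W.baseChange K).torsionGaloisModule ((p : ℕ) : ℤ)) (Sum.inr lam) 1 s)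
        (galoisCohomology.localization ((W.baseChange K).torsionGaloisModule ((p : ℕ) : ℤ)) (Sum.inr lam) 1 c') = 0 :=
    (hperf lam).1.injective (hPTsum.trans (map_zero _).symm)
  -- ### the local step at `K_λ`: bridge `Γ_K`-decomposition data ↔ `Γ_{K_λ}`
  haveI : Fact p.Prime := ⟨hp⟩
  haveI : CharZero (lam.adicCompletion K) :=
    charZero_of_injective_algebraMap (algebraMap K (lam.adicCompletion K)).injective
  -- good reduction at `λ`, `p ∉ λ`
  have hbad : lam ∉ (W.baseChange K).badPlaces (𝓞 K) := hℓ.not_mem_badPlaces hP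
  have hgood : (W.baseChange K).HasGoodReductionAt lam := by
    have h := hbad
    rwa [WeierstrassCurve.mem_badPlaces_iff, not_not] at h
  have hpv : ((p : ℕ) : 𝓞 K) ∉ lam.asIdeal :=
    not_natCast_mem_of_prime_ne hℓ.prime hp hℓ.2.2.2.1 lam hℓ.mem_place
  have hqv : ((((p : ℕ) : ℤ)) : 𝓞 K) ∉ lam.asIdeal := by
    rw [Int.cast_natCast]
    exact hpv
  -- the prime `𝔓₀ ∣ λ` cut out by `K̄ → \bar K_λ`; `g • 𝔔 = 𝔓₀` (transitivity of `Γ_K`)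
  have h𝔓₀ : adicCompletionPrime K lam ∈ lam.primesAbove := adicCompletionPrime_mem_primesAbove K lam
  obtain ⟨g, hg⟩ := HeightOneSpectrum.exists_smul_eq_of_mem_primesAbove_holds h𝔔 h𝔓₀
  have hDeq := decompositionSubgroup_adicCompletionPrime_eq_range K lam
  have hIeq := inertia_adicCompletionPrime_eq_map_absInertia K lam
  -- `F₀ = g F g⁻¹` is a Frobenius at `𝔓₀` fixing `E[p]`; `σ₀ = g σ g⁻¹ ∈ I_{𝔓₀}`
  have hF₀ : IsArithFrobAt (𝓞 K) (g * F * g⁻¹) (adicCompletionPrime K lam) := by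
    have h := hF.conj g
    rwa [hg] at h
  have hF₀fix : g * F * g⁻¹ ∈ torsionFixing (W.baseChange K) ((p : ℕ) : ℤ) :=
    (torsionFixing_normal (W.baseChange K) _).conj_mem F hFfix g
  have hσ₀ : g * σ * g⁻¹ ∈ (adicCompletionPrime K lam).inertia (absoluteGaloisGroup K) := by
    rw [← hg]
    intro x
    have hx := Ideal.smul_mem_pointwise_smul g _ 𝔔 (hσ (g⁻¹ • x))
    rwa [smul_sub, smul_inv_smul, ← mul_smul, ← mul_smul] at hx
  -- inertia at `𝔓₀` fixes `E[p]` (good reduction, `λ ∤ p`)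
  have hI₀ : (adicCompletionPrime K lam).inertia (absoluteGaloisGroup K) ≤
      torsionFixing (W.baseChange K) ((p : ℕ) : ℤ) := fun τ hτ =>
    (mem_torsionFixing_iff _ _).mpr fun Q =>
      (W.baseChange K).smul_geomTorsion_eq_of_mem_inertia hgood hqv h𝔓₀ hτ Q
  have hσ₀fix : g * σ * g⁻¹ ∈ torsionFixing (W.baseChange K) ((p : ℕ) : ℤ) := hI₀ hσ₀
  -- `F₀ = res gF`, `σ₀ = res t` with `t ∈ I_{K_λ}` (`D_{𝔓₀} = res Γ_{K_λ}`, `I_{𝔓₀} = res I_{K_λ}`)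
  obtain ⟨gF, hgF⟩ : ∃ gF : absoluteGaloisGroup (lam.adicCompletion K),
      absGaloisRestrict K (lam.adicCompletion K) gF = g * F * g⁻¹ := by
    have hmem : g * F * g⁻¹ ∈
        (adicCompletionPrime K lam).decompositionSubgroup (absoluteGaloisGroup K) :=
      hF₀.mem_stabilizer
    rw [hDeq] at hmem
    obtain ⟨gF, hgF⟩ := hmem
    exact ⟨gF, hgF⟩
  obtain ⟨t, ht, hgt⟩ : ∃ t ∈ absInertia (lam.adicCompletion K),
      absGaloisRestrict K (lam.adicCompletion K) t = g * σ * g⁻¹ := by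
    have hmem := hσ₀
    rw [hIeq] at hmem
    obtain ⟨t, ht, hgt⟩ := hmem
    exact ⟨t, ht, hgt⟩
  -- `Γ_{K_λ}` acts trivially on `E[p]`: `D_{𝔓₀} = ⟨F₀⟩ · I_{𝔓₀} · Γ_{K(E[p])}`
  have htriv : ∀ (g' : absoluteGaloisGroup (lam.adicCompletion K))
      (Q : geomTorsion (W.baseChange K) ((p : ℕ) : ℤ)),
      absGaloisRestrict K (lam.adicCompletion K) g' • Q = Q := by
    intro g' Q
    have hd : absGaloisRestrict K (lam.adicCompletion K) g' ∈
        (adicCompletionPrime K lam).decompositionSubgroup (absoluteGaloisGroup K) := by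
      rw [hDeq]; exact ⟨g', rfl⟩
    obtain ⟨k, i, u', hi, hu, hdeq⟩ := exists_eq_frobenius_pow_mul_of_mem_decompositionSubgroup
      h𝔓₀ hF₀ (isOpen_torsionFixing (W.baseChange K) hp0) hd
    have hmem : absGaloisRestrict K (lam.adicCompletion K) g' ∈
        torsionFixing (W.baseChange K) ((p : ℕ) : ℤ) := by
      rw [hdeq]
      exact Subgroup.mul_mem _ (Subgroup.mul_mem _ (Subgroup.pow_mem _ hF₀fix k) (hI₀ hi)) hu
    exact smul_eq_of_mem_torsionFixing _ _ hmem Q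
  -- the residue characteristic of `K_λ` is prime to `p` (`λ ∤ p`)
  have hn : ¬ ringChar 𝓀[lam.adicCompletion K] ∣ p := fun h =>
    GaloisImage.ringChar_residueField_adicCompletion_ne_of_not_mem lam p hpv
      ((Nat.prime_dvd_prime_iff_eq (ringChar_residueField_prime (F := lam.adicCompletion K)) hp).mp h).symm
  -- a frame `E[p] ≃ (ℤ/p)²` (the tree's frame at level `p^1`, rewritten along `p^1 = p`)
  have hframe := nonempty_addEquiv_geomTorsion (W.baseChange K) p 1 le_rfl (Nat.cast_ne_zero.mpr hp.ne_zero)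
  rw [pow_one] at hframe
  obtain ⟨ε₀⟩ := hframe
  let ε : geomTorsion (W.baseChange K) ((p : ℕ) : ℤ) ≃+ ZMod p × ZMod p :=
    ε₀.trans (LinearEquiv.finTwoArrow ℤ (ZMod p)).toAddEquiv
  -- the injective local invariant map at `λ`
  have hinv : Function.Injective (inv (Sum.inr lam)) := (hperf lam).1.injective
  -- the local cocycles: restrictions to `Γ_{K_λ}` of the chosen cocycles of `s` and `c'`
  let φ : contOneCocycles (DiscreteGaloisModule.toTopRep (GaloisRep.restrictField
      (lam.adicCompletion K) ((W.baseChange K).torsionGaloisModule ((p : ℕ) : ℤ)))) :=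
    contOneCocycles.pullback (absGaloisRestrict K (lam.adicCompletion K))
      (X := discreteTopRep (absoluteGaloisGroup K) (geomTorsion (W.baseChange K) ((p : ℕ) : ℤ)))
      (Y := DiscreteGaloisModule.toTopRep (GaloisRep.restrictField (lam.adicCompletion K)
        ((W.baseChange K).torsionGaloisModule ((p : ℕ) : ℤ))))
      (TopRep.ofHom ⟨ContinuousLinearMap.id ℤ _, fun _ => rfl⟩)
      (reprCocycle (W.baseChange K) ((p : ℕ) : ℤ) s)
  let ψ : contOneCocycles (DiscreteGaloisModule.toTopRep (GaloisRep.restrictField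
      (lam.adicCompletion K) ((W.baseChange K).torsionGaloisModule ((p : ℕ) : ℤ)))) :=
    contOneCocycles.pullback (absGaloisRestrict K (lam.adicCompletion K))
      (X := discreteTopRep (absoluteGaloisGroup K) (geomTorsion (W.baseChange K) ((p : ℕ) : ℤ)))
      (Y := DiscreteGaloisModule.toTopRep (GaloisRep.restrictField (lam.adicCompletion K)
        ((W.baseChange K).torsionGaloisModule ((p : ℕ) : ℤ))))
      (TopRep.ofHom ⟨ContinuousLinearMap.id ℤ _, fun _ => rfl⟩)
      (reprCocycle (W.baseChange K) ((p : ℕ) : ℤ) c')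
  have hφcl : galoisCohomology.localization ((W.baseChange K).torsionGaloisModule ((p : ℕ) : ℤ))
      (Sum.inr lam) 1 s = oneCocycleClass _ φ := by
    have h := (W.baseChange K).res_torsionGaloisModule_oneCocycleClass ((p : ℕ) : ℤ)
      (lam.adicCompletion K) (reprCocycle (W.baseChange K) ((p : ℕ) : ℤ) s)
    rw [oneCocycleClass_reprCocycle] at h
    exact h
  have hψcl : galoisCohomology.localization ((W.baseChange K).torsionGaloisModule ((p : ℕ) : ℤ))
      (Sum.inr lam) 1 c' = oneCocycleClass _ ψ := by
    have h := (W.baseChange K).res_torsionGaloisModule_oneCocycleClass ((p : ℕ) : ℤ)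
      (lam.adicCompletion K) (reprCocycle (W.baseChange K) ((p : ℕ) : ℤ) c')
    rw [oneCocycleClass_reprCocycle] at h
    exact h
  rw [hφcl, hψcl] at hcup
  -- `φ` vanishes on `I_{K_λ}`: `s` is Selmer at the good place `λ ∤ p` (Gross (7.1))
  have hsel : s ∈ selmerLocalKer (W.baseChange K) (lam.adicCompletion K) ((p : ℕ) : ℤ) :=
    ((mem_selmerGroup_iff (W.baseChange K) _ s).mp hs).1 lam
  have hsI : ∀ τ ∈ (adicCompletionPrime K lam).inertia (absoluteGaloisGroup K),
      (reprCocycle (W.baseChange K) ((p : ℕ) : ℤ) s).1 τ = 0 := by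
    have h := hsel
    rw [← oneCocycleClass_reprCocycle (W.baseChange K) ((p : ℕ) : ℤ) s] at h
    exact ((W.baseChange K).oneCocycleClass_mem_selmerLocalKer_iff hgood hqv h𝔓₀ _).mp h
  have hφ : ∀ t' ∈ absInertia (lam.adicCompletion K), φ.1 t' = 0 := by
    intro t' ht'
    have hmem : absGaloisRestrict K (lam.adicCompletion K) t' ∈
        (adicCompletionPrime K lam).inertia (absoluteGaloisGroup K) := by
      rw [hIeq]; exact ⟨t', ht', rfl⟩
    have h0 : (reprCocycle (W.baseChange K) ((p : ℕ) : ℤ) s).1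
        (absGaloisRestrict K (lam.adicCompletion K) t') = 0 := hsI _ hmem
    rw [contOneCocycles.pullback_apply, h0, map_zero]
  -- the local step at `K_λ`: `e([s, F₀], [c', σ₀]) = 1`
  have hloc := TameCup.weilPairing_apply_eq_one_of_cupProduct_eq_zero (W.baseChange K) p
    e hμ hadd₁ hadd₂ (lam.adicCompletion K) halt hnondeg hgal ε hn htriv (inv (Sum.inr lam)) hinv
    φ ψ hφ hcup gF t ht
  rw [contOneCocycles.pullback_apply, contOneCocycles.pullback_apply, hgF, hgt] at hloc
  change e (h1Eval (W.baseChange K) ((p : ℕ) : ℤ) s (g * F * g⁻¹))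
    (h1Eval (W.baseChange K) ((p : ℕ) : ℤ) c' (g * σ * g⁻¹)) = 1 at hloc
  -- transport along `g`: `[s, F] = g⁻¹ • [s, F₀]`, `[c', σ] = g⁻¹ • [c', σ₀]`, `e` equivariant
  have hconjF : g⁻¹ * (g * F * g⁻¹) * g⁻¹⁻¹ = F := by group
  have hconjσ : g⁻¹ * (g * σ * g⁻¹) * g⁻¹⁻¹ = σ := by group
  have h1 : h1Eval (W.baseChange K) ((p : ℕ) : ℤ) s F =
      g⁻¹ • h1Eval (W.baseChange K) ((p : ℕ) : ℤ) s (g * F * g⁻¹) := by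
    rw [← h1Eval_conj (W.baseChange K) _ s g⁻¹ hF₀fix, hconjF]
  have h2 : h1Eval (W.baseChange K) ((p : ℕ) : ℤ) c' σ =
      g⁻¹ • h1Eval (W.baseChange K) ((p : ℕ) : ℤ) c' (g * σ * g⁻¹) := by
    rw [← h1Eval_conj (W.baseChange K) _ c' g⁻¹ hσ₀fix, hconjσ]
  rw [TameCup.weilPairingHom_eq_zero_iff, h1, h2, ← hgal, hloc, smul_one]

/-! ## §2 Gross 1991, Prop. 8.2 — the named fact, CONDITIONAL on PT at universe `u`, and DISCHARGED at `K : Type` -/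

/-- **Gross 1991, Prop. 8.2 from Poitou–Tate**: the named fact `Gross1991_prop_8_2 N W K` (at a Kolyvagin place `λ`
with `d_λ ≠ 0`, `d` locally trivial elsewhere, every Selmer class in the same `τ`-eigenspace is locally trivial at
`λ`) from §1's reciprocity and the tree's per-instance eigen-argument `Gross1991_prop_8_2_at_of_reciprocity`
(McCallum §3; Gross §8). CONDITIONAL on `hPT : poitouTate_sum_localTatePairing_eq_zero K` (any universe).
[cite: GrossLMS1991, §8 Prop. 8.1 (2), Prop. 8.2, §7 (7.6), §9] [cite: McCallumLMS1991, §2 Prop. 2.2, §3] -/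
theorem gross1991_prop_8_2_of_poitouTate (hPT : poitouTate_sum_localTatePairing_eq_zero K) :
    Gross1991_prop_8_2 N W K := by
  unfold Gross1991_prop_8_2
  intro _ _ hK _ _ P hP p hp hp2 _ c hc ℓ hℓ ν hν d hd hfin hinf v hv hdv s hs hτs
  have hvw : v = hℓ.place := hℓ.mem_iff.mp hv
  subst hvw
  have hgood : (W.baseChange K).HasGoodReductionAt hℓ.place := by
    have h := IsKolyvaginPrime.not_mem_badPlaces (W := W) hP hℓ
    rwa [WeierstrassCurve.mem_badPlaces_iff, not_not] at h
  obtain ⟨A, _, e, halt, hnd, hRe⟩ := kolyvaginReciprocity_of_poitouTate N W K hPT hP hp hℓ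
  exact Gross1991_prop_8_2_at_of_reciprocity W hK hp hp2 hc hℓ hgood e halt hnd hν hd hdv
    hs hτs (fun 𝔔 h𝔔 F hF hFT σ hσ ↦ hRe s hs d hfin hinf 𝔔 h𝔔 F hF hFT σ hσ)

/-- **Gross 1991, Prop. 8.2 HOLDS** — `Gross1991_prop_8_2 N W K` for every number field `K : Type` (the universe of
the tree's Poitou–Tate discharge `poitouTate_sum_localTatePairing_eq_zero_holds`, cell bsd-cn100) and all `N`, `W`:
the second of the four outstanding leaves of `kolyvagin` (`kolyvagin_of_fourLeaves`) is discharged.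
[cite: GrossLMS1991, §8 Prop. 8.2] [cite: CasselsFrohlichANT1967, Ch. VII §11] [cite: MilneADT2006, Ch. I Thm. 4.10(b)] -/
theorem gross1991_prop_8_2_holds (N : ℕ) [NeZero N] (W : WeierstrassCurve ℚ) (K : Type) [Field K]
    [NumberField K] : Gross1991_prop_8_2 N W K :=
  gross1991_prop_8_2_of_poitouTate N W K (poitouTate_sum_localTatePairing_eq_zero_holds K)

/-! ## §3 Kolyvagin's theorem from THREE leaves -/

/-- **Kolyvagin's theorem (Gross 1991 Thm. 1.3 / Kolyvagin 1990 Thm. A) from its three remaining leaves**: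
`kolyvagin N W K` (for `K : Type`) from Kolyvagin's classes with Gross's Props. 5.4 (2) and 6.2 (`hA1`, Gross §§3–6:
CM theory over ring class fields, the Euler-system relations, Eichler–Shimura), the finiteness of the `p`-primary
parts of `Ш(E/K)` beyond Gross's sketch (`hSha`) and Theorem A in the cases `E` CM or `d_K ∈ {−3, −4}` (`hexc`) —
`kolyvagin_of_fourLeaves` with its duality leaf `Gross1991_prop_8_2` supplied by `gross1991_prop_8_2_holds`.
[cite: GrossLMS1991, §1 Thm. 1.3 with §2 (Props. 2.1, 2.3), §8 Prop. 8.2] [cite: McCallumLMS1991, §1 Theorem (Kolyvagin)] -/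
theorem kolyvagin_of_threeLeaves (N : ℕ) [NeZero N] (W : WeierstrassCurve ℚ) (K : Type) [Field K]
    [NumberField K] (hA1 : Gross1991_kolyvaginClasses N W K) (hSha : Kolyvagin1990_sha_primary_finite N W K)
    (hexc : Kolyvagin1990_thmA_of_hasCM_or_discr N W K) : kolyvagin N W K :=
  kolyvagin_of_fourLeaves N W K hA1 (gross1991_prop_8_2_holds N W K) hSha hexc

/-! ## §4 Back to crux Ko (stmt-BirchSwinnertonDyer-20480): line `birth` v3 with the Kolyvagin conjunct on three leaves -/

/-- **Crux Ko `WildKolyvaginUpperAtThree` BY NAME ⟸ J `WildSigmaDivisibilityAtThree` BY NAME (stmt-20760, OPEN) + the THREE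
remaining leaves of Kolyvagin's theorem (`Gross1991_kolyvaginClasses`, `Kolyvagin1990_sha_primary_finite`,
`Kolyvagin1990_thmA_of_hasCM_or_discr`, each for every `N`, `W`, `K : Type`) + the other three print conjuncts of
`stub_inputsPrim` (Cassels–Tate level inputs, Gross 3.7 (2), GZ86 III (3.1))** — lead g2's composition
`wildKolyvaginUpperAtThree_of_sigma_of_primitives` (p581112) with `kolyvagin` supplied by `kolyvagin_of_threeLeaves`.
CONDITIONAL on every displayed hypothesis; Ko and J stay open. [cite: GrossLMS1991, §1 Thm. 1.3, §8 Prop. 8.2]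
[cite: McCallumLMS1991, §5 Cor. 5.6 (p. 310)] [cite: Jetchev2008, Conj. 1.3 (p. 812)] -/
theorem wildKolyvaginUpperAtThree_of_sigma_of_threeLeaves
    (hJ : Summit.BirchSwinnertonDyer.BirchSwinnertonDyer.Theses.SemiOrdinaryEisensteinDescent.WildSigmaDivisibilityAtThree)
    (hA1 : ∀ (N : ℕ) [NeZero N] (W : WeierstrassCurve ℚ) (K : Type) [Field K] [NumberField K],
      Gross1991_kolyvaginClasses N W K)
    (hSha : ∀ (N : ℕ) [NeZero N] (W : WeierstrassCurve ℚ) (K : Type) [Field K] [NumberField K],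
      Kolyvagin1990_sha_primary_finite N W K)
    (hexc : ∀ (N : ℕ) [NeZero N] (W : WeierstrassCurve ℚ) (K : Type) [Field K] [NumberField K],
      Kolyvagin1990_thmA_of_hasCM_or_discr N W K)
    (hCT : ∀ (K : Type) [Field K] [NumberField K], casselsTate_levelInputs K)
    (h372 : GrossLMS1991.prop37_2_frobeniusCongruence)
    (hE0 : Gross1991_heegnerPoint_sub_ratTorsion_mem_E0) :
    Summit.BirchSwinnertonDyer.BirchSwinnertonDyer.Theses.SemiOrdinaryEisensteinDescent.WildKolyvaginUpperAtThree :=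
  WildKolyvaginUpperAtThreeOfPrimitives.wildKolyvaginUpperAtThree_of_sigma_of_primitives hJ
    (fun N _ W K _ _ ↦ kolyvagin_of_threeLeaves N W K (hA1 N W K) (hSha N W K) (hexc N W K)) hCT h372 hE0

end Summit.BirchSwinnertonDyer.BirchSwinnertonDyer.Theorems.GrossProp82OfPoitouTate

end
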